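import Literature.Analysis.PDE.SupBound
import Mathlib.Analysis.Normed.Operator.Extend
import Mathlib.Analysis.InnerProductSpace.Dual
import Mathlib.Analysis.Calculus.UniformLimitsDeriv
import HarnessLib

/-!
# Point evaluations on the Sobolev tuple spaces `𝐇_s`: continuous representatives, their
# derivatives, and uniform convergence of bounded weakly convergent sequences

Function-space layer of the energy-method programme for short-time existence of quasilinear
strictly parabolic second-order systems on a closed manifold (hypothesis `hQL` of
`Literature.Geometry.Riemannian.ricciFlow_shortTime_existence_of_quasilinear`). The nonlinear
operator of that programme is evaluated on the CONTINUOUS REPRESENTATIVES of the elements of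
`𝐇_s` (`SobolevTupleSpace.lean`) and of their derivatives of order `≤ s - dim - 1`; this file
constructs them as continuous linear maps and proves the two properties the Galerkin method
needs (Kato–Lai 1984, Thm. A, hypothesis "`A` sequentially weakly continuous"):

* `Hs.ev k v x : 𝐇_s →L[ℝ] W` — **evaluation of the `v`-th derivative of the `k`-th component at
  `x`**, the unique continuous linear extension (Mathlib's `ContinuousLinearMap.extend` along the
  dense isometric inclusion of the smooth jets) of `jetH s u ↦ ∂_v u_k (x)`, bounded by the
  pointwise Sobolev bound of `SupBound.lean` (`|v| + dim ≤ s`); `ev_jetH`, `ev_unique`,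
  uniform bounds on balls (`exists_norm_ev_le`) and the equi-Lipschitz bound
  (`exists_norm_ev_sub_ev_le`, `|v| + 1 + dim ≤ s`);
* `Hs.rep k U x = ev k [] x U` — **the continuous representative**; it is `C¹` with
  `∂_i (rep k U) = ev k [i] · U`, and inductively `∂_v (rep k U) (x) = ev k v x U`
  (`hasFDerivAt_evFun`, `cwd_rep`), all derivatives up to order `m` being continuous when
  `m + 1 + dim ≤ s` (`contDiff_rep`);
* `tendstoUniformlyOn_ev_of_weak` — **bounded weakly convergent sequences converge uniformly on
  balls together with their derivatives of order `≤ s - dim - 1`**: pointwise convergence because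
  `ev` is continuous linear (Riesz), uniformity from the equi-Lipschitz bound and compactness of
  balls (`tendstoUniformlyOn_of_lipschitzOnWith`) — the compactness-free substitute for
  Rellich's lemma used to verify weak sequential continuity of the Galerkin operator.

Everything is proved; no named fact and no `sorry` is introduced.

## References

* L. C. Evans, *Partial Differential Equations*, 2nd ed., AMS 2010, §5.6.3, Thm. 6 (general
  Sobolev inequalities: `u ∈ W^{k,p}`, `k > n/p`, has a `C^{k-[n/p]-1,γ}` representative).
  [Evans2010]
* T. Kato, C. Y. Lai, Nonlinear evolution equations and the Euler flow, J. Funct. Anal. 56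
  (1984) 15–28, §3, Thm. A. [KatoLai1984]
-/

noncomputable section

open MeasureTheory Set Function Filter Metric
open scoped ContDiff Topology RealInnerProductSpace ENNReal NNReal

namespace Literature.Analysis.PDE

open Literature.Analysis.FunctionSpaces

variable {ι : Type*} [Fintype ι] [DecidableEq ι]
variable {W : Type*} [NormedAddCommGroup W] [InnerProductSpace ℝ W]
variable {N s : ℕ}

/-! ### Injectivity of the jet map and the preimage of a smooth jet -/

omit [DecidableEq ι] in
/-- **The jet map is injective on smooth tuples** (continuous functions that agree a.e. for a
measure positive on open sets agree everywhere). [folklore] -/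
theorem jetL_injective : Function.Injective (jetL (W := W) (N := N) (ι := ι) s) := by
  intro u u' h
  have hae : jetFun s u.1 =ᵐ[volume] jetFun s u'.1 :=
    (coeFn_jetL (s := s) u).symm.trans ((Lp.ext_iff.1 h).trans (coeFn_jetL (s := s) u'))
  have heq : jetFun s u.1 = jetFun s u'.1 :=
    (Continuous.ae_eq_iff_eq volume (continuous_jetFun u.2) (continuous_jetFun u'.2)).1 hae
  apply Subtype.ext
  funext k x
  have h1 := congrArg (fun t : JetVal W N s ι => t (k, OWord.zero ι s)) (congrFun heq x)
  simpa using h1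

/-- A smooth preimage of an element of `smoothRange`. [folklore] -/
def pre (U : smoothRange W N s ι) : smoothCS W N ι := Classical.choose U.2

omit [DecidableEq ι] in
/-- `jetL s (pre U) = U`. [folklore] -/
@[simp]
theorem jetL_pre (U : smoothRange W N s ι) : jetL s (pre U) = (U : L2Jet W N s ι) :=
  Classical.choose_spec U.2

omit [DecidableEq ι] in
/-- The preimage of a smooth jet is the tuple itself. [folklore] -/
theorem pre_mk_jetL (u : smoothCS W N ι) : pre (⟨jetL s u, u, rfl⟩ : smoothRange W N s ι) = u :=
  jetL_injective (by rw [jetL_pre])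

omit [DecidableEq ι] in
/-- `pre` is additive. [folklore] -/
theorem pre_add (U V : smoothRange W N s ι) : pre (U + V) = pre U + pre V :=
  jetL_injective (by rw [jetL_pre, map_add, jetL_pre, jetL_pre]; rfl)

omit [DecidableEq ι] in
/-- `pre` is homogeneous. [folklore] -/
theorem pre_smul (c : ℝ) (U : smoothRange W N s ι) : pre (c • U) = c • pre U :=
  jetL_injective (by rw [jetL_pre, map_smul, jetL_pre]; rfl)

/-! ### The dense isometric inclusion `smoothRange → 𝐇_s` -/

/-- The inclusion of the smooth jets into `𝐇_s` as a continuous linear map. [folklore] -/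
def inclHs (W : Type*) [NormedAddCommGroup W] [InnerProductSpace ℝ W] (N s : ℕ) (ι : Type*)
    [Fintype ι] : smoothRange W N s ι →L[ℝ] Hs W N s ι :=
  (Submodule.inclusion smoothRange_le_Hs).mkContinuous 1 fun U => by
    simp [Submodule.coe_inclusion, Submodule.coe_norm]

omit [DecidableEq ι] in
/-- Coercion of `inclHs`. [folklore] -/
@[simp]
theorem coe_inclHs (U : smoothRange W N s ι) : (inclHs W N s ι U : L2Jet W N s ι) = U := rfl

omit [DecidableEq ι] in
/-- `inclHs ⟨jetL s u, _⟩ = jetH s u`. [folklore] -/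
theorem inclHs_mk_jetL (u : smoothCS W N ι) :
    inclHs W N s ι ⟨jetL s u, u, rfl⟩ = jetH s u := rfl

omit [DecidableEq ι] in
/-- `inclHs` is an isometry. [folklore] -/
theorem norm_inclHs (U : smoothRange W N s ι) : ‖inclHs W N s ι U‖ = ‖U‖ := rfl

omit [DecidableEq ι] in
/-- `inclHs` has dense range. [folklore] -/
theorem denseRange_inclHs : DenseRange (inclHs W N s ι) := by
  refine (denseRange_jetH (W := W) (N := N) (ι := ι) (s := s)).mono ?_
  rintro _ ⟨u, rfl⟩
  exact ⟨⟨jetL s u, u, rfl⟩, rfl⟩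

omit [DecidableEq ι] in
/-- `inclHs` is uniformly inducing (an isometry). [folklore] -/
theorem isUniformInducing_inclHs : IsUniformInducing (inclHs W N s ι) :=
  (AddMonoidHomClass.isometry_of_norm (inclHs W N s ι) norm_inclHs).isUniformInducing

/-! ### Canonical cut-offs -/

omit [DecidableEq ι] in
/-- A smooth compactly supported cut-off equal to `1` on a neighbourhood of the closed ball of
radius `R` about the origin. [folklore] -/
theorem exists_cutoff_closedBall (R : ℝ) (hR : 0 < R) :
    ∃ θ : EuclideanSpace ℝ ι → ℝ, ContDiff ℝ ∞ θ ∧ HasCompactSupport θ ∧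
      ∀ x ∈ closedBall (0 : EuclideanSpace ℝ ι) R, θ =ᶠ[𝓝 x] fun _ => 1 := by
  let b : ContDiffBump (0 : EuclideanSpace ℝ ι) := ⟨R + 1, R + 2, by linarith, by linarith⟩
  refine ⟨b, b.contDiff, b.hasCompactSupport, fun x hx => ?_⟩
  have hball : ball x 1 ⊆ closedBall (0 : EuclideanSpace ℝ ι) (R + 1) := by
    intro y hy
    rw [mem_closedBall, dist_zero_right]
    rw [mem_closedBall, dist_zero_right] at hx
    rw [mem_ball] at hy
    calc ‖y‖ = ‖(y - x) + x‖ := by rw [sub_add_cancel]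
      _ ≤ ‖y - x‖ + ‖x‖ := norm_add_le _ _
      _ ≤ 1 + R := by rw [← dist_eq_norm]; linarith
      _ = R + 1 := add_comm _ _
  filter_upwards [ball_mem_nhds x one_pos] with y hy
  exact b.one_of_mem_closedBall (hball hy)

/-! ### Evaluation functionals -/

section Ev

variable [CompleteSpace W]

/-- The evaluation of the `v`-th derivative of the `k`-th component at `x` on the smooth jets,
as a linear map. [folklore] -/
def evRangeₗ (k : Fin N) (v : List ι) (x : EuclideanSpace ℝ ι) : smoothRange W N s ι →ₗ[ℝ] W where
  toFun U := cwd v ((pre U).1 k) x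
  map_add' U V := by
    rw [pre_add]
    change cwd v ((pre U).1 k + (pre V).1 k) x = _
    rw [cwd_add ((pre U).2 k).1 ((pre V).2 k).1]
    rfl
  map_smul' c U := by
    rw [pre_smul, RingHom.id_apply]
    exact congrFun (cwd_const_smul ((pre U).2 k).1 c v) x

omit [DecidableEq ι] [CompleteSpace W] in
/-- Value of `evRangeₗ` on a smooth jet. [folklore] -/
theorem evRangeₗ_mk_jetL (k : Fin N) (v : List ι) (x : EuclideanSpace ℝ ι) (u : smoothCS W N ι) :
    evRangeₗ (s := s) k v x ⟨jetL s u, u, rfl⟩ = cwd v (u.1 k) x := by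
  change cwd v ((pre (⟨jetL s u, u, rfl⟩ : smoothRange W N s ι)).1 k) x = _
  rw [pre_mk_jetL]

omit [CompleteSpace W] in
/-- **Boundedness of evaluation on smooth jets, uniformly on a ball**: for `m + dim ≤ s` and
`R > 0` there is `C` with `‖∂_v (pre U)_k (x)‖ ≤ C ‖U‖` for `|v| ≤ m`, `‖x‖ ≤ R`. [cite: Evans2010, §5.6.3, Thm. 6] -/
theorem exists_norm_evRangeₗ_le {m : ℕ} (hms : m + Fintype.card ι ≤ s) {R : ℝ} (hR : 0 < R) :
    ∃ C : ℝ, 0 ≤ C ∧ ∀ (k : Fin N) (v : List ι), v.length ≤ m →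
      ∀ x ∈ closedBall (0 : EuclideanSpace ℝ ι) R, ∀ U : smoothRange W N s ι,
        ‖evRangeₗ k v x U‖ ≤ C * ‖U‖ := by
  obtain ⟨θ, hθ, hθc, hθ1⟩ := exists_cutoff_closedBall (ι := ι) R hR
  obtain ⟨C, hC0, hC⟩ := exists_norm_cwd_le_norm_jetL (W := W) (N := N) hθ hθc hms
  refine ⟨C, hC0, fun k v hv x hx U => ?_⟩
  have h := hC (pre U) k v hv x (hθ1 x hx)
  rw [jetL_pre] at h
  exact h

/-- **The evaluation functional `ev k v x : 𝐇_s →L W`**: for `|v| + dim ≤ s`, the unique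
continuous linear extension to `𝐇_s` of `jetH s u ↦ ∂_v u_k (x)`; `0` otherwise (junk value,
never used). [cite: Evans2010, §5.6.3, Thm. 6] -/
def Hs.ev (k : Fin N) (v : List ι) (x : EuclideanSpace ℝ ι) : Hs W N s ι →L[ℝ] W :=
  if h : v.length + Fintype.card ι ≤ s then
    ((evRangeₗ (s := s) k v x).mkContinuous
      (Classical.choose (exists_norm_evRangeₗ_le (W := W) (N := N) (m := v.length) h
        (R := ‖x‖ + 1) (by positivity)))
      fun U => (Classical.choose_spec (exists_norm_evRangeₗ_le (W := W) (N := N)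
        (m := v.length) h (R := ‖x‖ + 1) (by positivity))).2 k v le_rfl x
          (by simp) U).extend (inclHs W N s ι)
  else 0

/-- **`ev` on smooth jets**: `ev k v x (jetH s u) = ∂_v u_k (x)` for `|v| + dim ≤ s`. [folklore] -/
theorem ev_jetH {k : Fin N} {v : List ι} (hv : v.length + Fintype.card ι ≤ s)
    (x : EuclideanSpace ℝ ι) (u : smoothCS W N ι) :
    Hs.ev k v x (jetH s u) = cwd v (u.1 k) x := by
  rw [Hs.ev, dif_pos hv, ← inclHs_mk_jetL,
    ContinuousLinearMap.extend_eq (e := inclHs W N s ι) _ denseRange_inclHs isUniformInducing_inclHs]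
  exact evRangeₗ_mk_jetL k v x u

/-- **Uniqueness**: a continuous linear map on `𝐇_s` that evaluates `∂_v u_k (x)` on smooth jets
is `ev k v x`. [folklore] -/
theorem ev_unique {k : Fin N} {v : List ι} (hv : v.length + Fintype.card ι ≤ s)
    (x : EuclideanSpace ℝ ι) (T : Hs W N s ι →L[ℝ] W)
    (hT : ∀ u : smoothCS W N ι, T (jetH s u) = cwd v (u.1 k) x) : T = Hs.ev k v x := by
  refine ContinuousLinearMap.ext fun U => ?_
  have hd := denseRange_jetH (W := W) (N := N) (ι := ι) (s := s)
  refine hd.induction_on U (isClosed_eq T.continuous (Hs.ev k v x).continuous) fun u => ?_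
  rw [hT, ev_jetH hv]

/-- **Uniform bound on balls**: for `m + dim ≤ s` and `R > 0` there is `C` with
`‖ev k v x U‖ ≤ C ‖U‖` for all `|v| ≤ m`, `‖x‖ ≤ R`, `U ∈ 𝐇_s`. [cite: Evans2010, §5.6.3, Thm. 6] -/
theorem exists_norm_ev_le {m : ℕ} (hms : m + Fintype.card ι ≤ s) {R : ℝ} (hR : 0 < R) :
    ∃ C : ℝ, 0 ≤ C ∧ ∀ (k : Fin N) (v : List ι), v.length ≤ m →
      ∀ x ∈ closedBall (0 : EuclideanSpace ℝ ι) R, ∀ U : Hs W N s ι,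
        ‖Hs.ev k v x U‖ ≤ C * ‖U‖ := by
  obtain ⟨C, hC0, hC⟩ := exists_norm_evRangeₗ_le (W := W) (N := N) hms hR
  refine ⟨C, hC0, fun k v hv x hx U => ?_⟩
  have hv' : v.length + Fintype.card ι ≤ s := by omega
  have hd := denseRange_jetH (W := W) (N := N) (ι := ι) (s := s)
  refine hd.induction_on U (isClosed_le ((Hs.ev k v x).continuous.norm)
    (continuous_const.mul continuous_norm)) fun u => ?_
  rw [ev_jetH hv']
  have h := hC k v hv x hx ⟨jetL s u, u, rfl⟩
  rwa [evRangeₗ_mk_jetL] at h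

/-- **Equi-Lipschitz bound**: for `m + 1 + dim ≤ s` and `R > 0` there is `C` with
`‖ev k v x U - ev k v x' U‖ ≤ C ‖U‖ ‖x - x'‖` for `|v| ≤ m`, `x, x'` in the closed ball of radius
`R`. [cite: Evans2010, §5.6.3, Thm. 6] -/
theorem exists_norm_ev_sub_ev_le {m : ℕ} (hms : m + 1 + Fintype.card ι ≤ s) {R : ℝ} (hR : 0 < R) :
    ∃ C : ℝ, 0 ≤ C ∧ ∀ (k : Fin N) (v : List ι), v.length ≤ m →
      ∀ x ∈ closedBall (0 : EuclideanSpace ℝ ι) R, ∀ x' ∈ closedBall (0 : EuclideanSpace ℝ ι) R,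
        ∀ U : Hs W N s ι, ‖Hs.ev k v x U - Hs.ev k v x' U‖ ≤ C * ‖U‖ * ‖x - x'‖ := by
  obtain ⟨θ, hθ, hθc, hθ1⟩ := exists_cutoff_closedBall (ι := ι) R hR
  obtain ⟨C, hC0, hC⟩ := exists_norm_cwd_sub_le_norm_jetL (W := W) (N := N) hθ hθc hms
    (convex_closedBall (0 : EuclideanSpace ℝ ι) R) hθ1
  refine ⟨C, hC0, fun k v hv x hx x' hx' U => ?_⟩
  have hv' : v.length + Fintype.card ι ≤ s := by omega
  have hd := denseRange_jetH (W := W) (N := N) (ι := ι) (s := s)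
  refine hd.induction_on U (isClosed_le (((Hs.ev k v x).continuous.sub
    (Hs.ev k v x').continuous).norm) ((continuous_const.mul continuous_norm).mul continuous_const))
    fun u => ?_
  rw [ev_jetH hv', ev_jetH hv']
  exact hC u k v hv x hx x' hx'

end Ev

/-! ### The continuous representative and its derivatives -/

section Rep

variable [CompleteSpace W]

/-- The function `x ↦ ev k v x U` (the continuous representative of the `v`-th derivative of
the `k`-th component of `U`). [folklore] -/
def Hs.evFun (k : Fin N) (v : List ι) (U : Hs W N s ι) : EuclideanSpace ℝ ι → W :=
  fun x => Hs.ev k v x U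

/-- **The continuous representative** of the `k`-th component of `U ∈ 𝐇_s`. [folklore] -/
def Hs.rep (k : Fin N) (U : Hs W N s ι) : EuclideanSpace ℝ ι → W := Hs.evFun k [] U

/-- Unfolding. [folklore] -/
theorem evFun_apply (k : Fin N) (v : List ι) (U : Hs W N s ι) (x : EuclideanSpace ℝ ι) :
    Hs.evFun k v U x = Hs.ev k v x U := rfl

/-- Unfolding. [folklore] -/
theorem rep_apply (k : Fin N) (U : Hs W N s ι) (x : EuclideanSpace ℝ ι) :
    Hs.rep k U x = Hs.ev k [] x U := rfl

/-- On smooth jets the representative of the derivative is the derivative. [folklore] -/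
theorem evFun_jetH {k : Fin N} {v : List ι} (hv : v.length + Fintype.card ι ≤ s)
    (u : smoothCS W N ι) : Hs.evFun k v (jetH s u) = cwd v (u.1 k) := by
  funext x
  exact ev_jetH hv x u

/-- **Approximation**: if `jetH s uₙ → U` in `𝐇_s` then `∂_v (uₙ)_k → evFun k v U` uniformly on
every ball (`|v| + dim ≤ s`). [folklore] -/
theorem tendstoUniformlyOn_cwd_of_tendsto {k : Fin N} {v : List ι}
    (hv : v.length + Fintype.card ι ≤ s) {u : ℕ → smoothCS W N ι} {U : Hs W N s ι}
    (hu : Tendsto (fun n => jetH s (u n)) atTop (𝓝 U)) (R : ℝ) :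
    TendstoUniformlyOn (fun n => cwd v ((u n).1 k)) (Hs.evFun k v U) atTop
      (closedBall (0 : EuclideanSpace ℝ ι) R) := by
  obtain ⟨C, hC0, hC⟩ := exists_norm_ev_le (W := W) (N := N) (m := v.length) hv
    (R := max R 1) (by positivity)
  rw [Metric.tendstoUniformlyOn_iff]
  intro ε hε
  have hε' : 0 < ε / (C + 1) := div_pos hε (by linarith)
  have h := (Metric.tendsto_nhds.1 hu) (ε / (C + 1)) hε'
  filter_upwards [h] with n hn x hx
  have hx' : x ∈ closedBall (0 : EuclideanSpace ℝ ι) (max R 1) :=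
    closedBall_subset_closedBall (le_max_left _ _) hx
  rw [dist_eq_norm, evFun_apply, ← ev_jetH hv x (u n), ← map_sub]
  calc ‖Hs.ev k v x (U - jetH s (u n))‖ ≤ C * ‖U - jetH s (u n)‖ := hC k v le_rfl x hx' _
    _ ≤ (C + 1) * ‖U - jetH s (u n)‖ := by gcongr; linarith
    _ < (C + 1) * (ε / (C + 1)) := by
        refine mul_lt_mul_of_pos_left ?_ (by linarith)
        rwa [dist_eq_norm, norm_sub_rev] at hn
    _ = ε := by field_simp

omit [DecidableEq ι] [CompleteSpace W] in
/-- Every element of `𝐇_s` is the limit of a SEQUENCE of smooth jets. [folklore] -/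
theorem exists_seq_tendsto_jetH (U : Hs W N s ι) :
    ∃ u : ℕ → smoothCS W N ι, Tendsto (fun n => jetH s (u n)) atTop (𝓝 U) := by
  have h := denseRange_jetH (W := W) (N := N) (ι := ι) (s := s)
  have hU : U ∈ closure (range (jetH (W := W) (N := N) (ι := ι) s)) := h.closure_eq ▸ mem_univ U
  obtain ⟨V, hV, hVt⟩ := mem_closure_iff_seq_limit.1 hU
  choose u hu using hV
  exact ⟨u, by simpa only [hu] using hVt⟩

/-- **Continuity of the representatives** of the derivatives of order `≤ s - dim`. [folklore] -/
theorem continuous_evFun {k : Fin N} {v : List ι} (hv : v.length + Fintype.card ι ≤ s)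
    (U : Hs W N s ι) : Continuous (Hs.evFun k v U) := by
  obtain ⟨u, hu⟩ := exists_seq_tendsto_jetH U
  rw [continuous_iff_continuousAt]
  intro x
  have hR : x ∈ ball (0 : EuclideanSpace ℝ ι) (‖x‖ + 1) := by simp
  have ht := tendstoUniformlyOn_cwd_of_tendsto (k := k) hv hu (‖x‖ + 1)
  have hc : ContinuousOn (Hs.evFun k v U) (closedBall (0 : EuclideanSpace ℝ ι) (‖x‖ + 1)) :=
    ht.continuousOn (Eventually.of_forall fun n =>
      (continuous_cwd ((u n).2 k).1 v).continuousOn).frequently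
  exact hc.continuousAt (mem_of_superset (isOpen_ball.mem_nhds hR) ball_subset_closedBall)

/-- The candidate derivative of `evFun k v U`: `e ↦ Σᵢ eᵢ • ev k (i :: v) x U`. [folklore] -/
def Hs.evDeriv (k : Fin N) (v : List ι) (U : Hs W N s ι) (x : EuclideanSpace ℝ ι) :
    EuclideanSpace ℝ ι →L[ℝ] W :=
  ∑ i : ι, (EuclideanSpace.proj i).smulRight (Hs.ev k (i :: v) x U)

/-- `evDeriv` applied to a frame vector. [folklore] -/
@[simp]
theorem evDeriv_apply_bv (k : Fin N) (v : List ι) (U : Hs W N s ι) (x : EuclideanSpace ℝ ι) (j : ι) :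
    Hs.evDeriv k v U x (bv j) = Hs.ev k (j :: v) x U := by
  simp only [Hs.evDeriv, FunLike.coe_sum, Finset.sum_apply,
    ContinuousLinearMap.smulRight_apply, PiLp.proj_apply]
  rw [Finset.sum_eq_single j]
  · rw [bv_eq_single, PiLp.single_apply, if_pos rfl, one_smul]
  · intro i _ hij
    rw [bv_eq_single, PiLp.single_apply, if_neg hij, zero_smul]
  · intro h; exact absurd (Finset.mem_univ j) h

omit [CompleteSpace W] in
/-- The Fréchet derivative of a smooth map, expanded in the frame. [folklore] -/
theorem fderiv_eq_sum_smulRight {f : EuclideanSpace ℝ ι → W} (x : EuclideanSpace ℝ ι) :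
    fderiv ℝ f x = ∑ i : ι, (EuclideanSpace.proj i).smulRight (fderiv ℝ f x (bv i)) := by
  classical
  refine ContinuousLinearMap.ext fun e => ?_
  have he : e = ∑ i, e i • (bv i : EuclideanSpace ℝ ι) := by
    simpa [bv_def] using ((EuclideanSpace.basisFun ι ℝ).sum_repr e).symm
  conv_lhs => rw [he]
  simp [map_sum, map_smul]

/-- **Differentiability of the representatives**: for `|v| + 1 + dim ≤ s`,
`x ↦ ev k v x U` has Fréchet derivative `evDeriv k v U x`, i.e. `∂_i` of it is `ev k (i :: v) · U`
(uniform limits of derivatives, Mathlib's `hasFDerivAt_of_tendstoLocallyUniformlyOn`).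
[cite: Evans2010, §5.6.3, Thm. 6] -/
theorem hasFDerivAt_evFun {k : Fin N} {v : List ι} (hv : v.length + 1 + Fintype.card ι ≤ s)
    (U : Hs W N s ι) (x : EuclideanSpace ℝ ι) :
    HasFDerivAt (Hs.evFun k v U) (Hs.evDeriv k v U x) x := by
  obtain ⟨u, hu⟩ := exists_seq_tendsto_jetH U
  have hv0 : v.length + Fintype.card ι ≤ s := by omega
  have hv1 : ∀ i : ι, (i :: v).length + Fintype.card ι ≤ s := fun i => by simp; omega
  set R : ℝ := ‖x‖ + 1 with hR
  have hxR : x ∈ ball (0 : EuclideanSpace ℝ ι) R := by simp [hR]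
  -- uniform convergence of the derivatives on the ball
  have hderiv : TendstoUniformlyOn (fun n y => fderiv ℝ (cwd v ((u n).1 k)) y)
      (Hs.evDeriv k v U) atTop (ball (0 : EuclideanSpace ℝ ι) R) := by
    rw [Metric.tendstoUniformlyOn_iff]
    intro ε hε
    have hε' : 0 < ε / (Fintype.card ι + 1) := div_pos hε (by positivity)
    have hall : ∀ i : ι, ∀ᶠ n in atTop, ∀ y ∈ closedBall (0 : EuclideanSpace ℝ ι) R,
        dist (Hs.evFun k (i :: v) U y) (cwd (i :: v) ((u n).1 k) y) < ε / (Fintype.card ι + 1) :=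
      fun i => (Metric.tendstoUniformlyOn_iff.1
        (tendstoUniformlyOn_cwd_of_tendsto (k := k) (hv1 i) hu R)) _ hε'
    filter_upwards [(Finset.univ : Finset ι).eventually_all.2 fun i _ => hall i] with n hn y hy
    have hy' : y ∈ closedBall (0 : EuclideanSpace ℝ ι) R := ball_subset_closedBall hy
    rw [dist_eq_norm]
    calc ‖Hs.evDeriv k v U y - fderiv ℝ (cwd v ((u n).1 k)) y‖
        ≤ ∑ i, ‖(Hs.evDeriv k v U y - fderiv ℝ (cwd v ((u n).1 k)) y) (bv i)‖ :=
          opNorm_le_sum_norm_apply_bv _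
      _ ≤ ∑ _i : ι, ε / (Fintype.card ι + 1) := by
          refine Finset.sum_le_sum fun i _ => ?_
          rw [sub_apply, evDeriv_apply_bv, ← dist_eq_norm]
          exact (hn i (Finset.mem_univ i) y hy').le
      _ = Fintype.card ι * (ε / (Fintype.card ι + 1)) := by
          rw [Finset.sum_const, nsmul_eq_mul, Finset.card_univ]
      _ < ε := by
          rw [← mul_div_assoc, div_lt_iff₀ (by positivity)]
          nlinarith
  have hloc : TendstoLocallyUniformlyOn (fun n y => fderiv ℝ (cwd v ((u n).1 k)) y)
      (Hs.evDeriv k v U) atTop (ball (0 : EuclideanSpace ℝ ι) R) :=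
    hderiv.tendstoLocallyUniformlyOn
  have hdiff : ∀ n, ∀ y ∈ ball (0 : EuclideanSpace ℝ ι) R,
      HasFDerivAt (cwd v ((u n).1 k)) (fderiv ℝ (cwd v ((u n).1 k)) y) y :=
    fun n y _ => ((differentiable_cwd ((u n).2 k).1 v) y).hasFDerivAt
  have hptw : ∀ y ∈ ball (0 : EuclideanSpace ℝ ι) R,
      Tendsto (fun n => cwd v ((u n).1 k) y) atTop (𝓝 (Hs.evFun k v U y)) := fun y hy =>
    (tendstoUniformlyOn_cwd_of_tendsto (k := k) hv0 hu R).tendsto_at (ball_subset_closedBall hy)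
  exact hasFDerivAt_of_tendstoLocallyUniformlyOn isOpen_ball hloc hdiff hptw hxR

/-- `∂_i (evFun k v U) = evFun k (i :: v) U` for `|v| + 1 + dim ≤ s`. [folklore] -/
theorem cwd_singleton_evFun {k : Fin N} {v : List ι} (hv : v.length + 1 + Fintype.card ι ≤ s)
    (U : Hs W N s ι) (i : ι) : cwd [i] (Hs.evFun k v U) = Hs.evFun k (i :: v) U := by
  funext x
  rw [cwd_singleton]
  change fderiv ℝ (Hs.evFun k v U) x (bv i) = _
  rw [(hasFDerivAt_evFun hv U x).fderiv, evDeriv_apply_bv]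
  rfl

/-- **Word derivatives of the representative**: `∂_v (rep k U) = evFun k v U` for
`|v| + dim ≤ s` (and `|v| ≥ 1` needs one spare derivative at each intermediate step, which the
hypothesis `|v| + dim ≤ s` provides since intermediate words are shorter). [folklore] -/
theorem cwd_rep {k : Fin N} (U : Hs W N s ι) :
    ∀ v : List ι, v.length + Fintype.card ι ≤ s → cwd v (Hs.rep k U) = Hs.evFun k v U
  | [], _ => rfl
  | i :: v, hv => by
    have hv' : v.length + 1 + Fintype.card ι ≤ s := by simp at hv; omega
    have ih := cwd_rep (k := k) U v (by omega)
    rw [show (i :: v) = [i] ++ v from rfl, cwd_append, ih]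
    exact cwd_singleton_evFun hv' U i

/-- **Smoothness of the representatives**: `evFun k v U` is `C^m` whenever
`|v| + m + dim ≤ s`... in the form: for all `m`, all `v` with `v.length + m + dim ≤ s`,
`ContDiff ℝ m (evFun k v U)`. [cite: Evans2010, §5.6.3, Thm. 6] -/
theorem contDiff_evFun {k : Fin N} (U : Hs W N s ι) :
    ∀ (m : ℕ) (v : List ι), v.length + m + Fintype.card ι ≤ s → ContDiff ℝ m (Hs.evFun k v U)
  | 0, v, hv => contDiff_zero.2 (continuous_evFun (by omega) U)
  | m + 1, v, hv => by
    have hv1 : v.length + 1 + Fintype.card ι ≤ s := by omega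
    rw [show ((m + 1 : ℕ) : WithTop ℕ∞) = (m : WithTop ℕ∞) + 1 from by push_cast; rfl,
      contDiff_succ_iff_hasFDerivAt]
    refine ⟨Hs.evDeriv k v U, ?_, fun x => hasFDerivAt_evFun hv1 U x⟩
    unfold Hs.evDeriv
    refine ContDiff.sum fun i _ => ?_
    have hi : ContDiff ℝ m (Hs.evFun k (i :: v) U) := contDiff_evFun U m (i :: v) (by simp; omega)
    exact (contDiff_const (c := EuclideanSpace.proj (𝕜 := ℝ) i)).smulRight hi

/-- `rep k U` is `C^m` when `m + dim ≤ s`. [cite: Evans2010, §5.6.3, Thm. 6] -/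
theorem contDiff_rep {k : Fin N} (U : Hs W N s ι) {m : ℕ} (hm : m + Fintype.card ι ≤ s) :
    ContDiff ℝ m (Hs.rep k U) :=
  contDiff_evFun U m [] (by simpa using hm)

/-- On smooth jets the representative is the function itself (`dim ≤ s`). [folklore] -/
theorem rep_jetH {k : Fin N} (hs : Fintype.card ι ≤ s) (u : smoothCS W N ι) :
    Hs.rep k (jetH s u) = u.1 k := by
  funext x
  rw [rep_apply, ev_jetH (by simpa using hs)]
  rfl

/-- `rep` is linear: additivity. [folklore] -/
theorem rep_add (k : Fin N) (U V : Hs W N s ι) : Hs.rep k (U + V) = Hs.rep k U + Hs.rep k V := by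
  funext x; simp [rep_apply]

/-- `rep` is linear: homogeneity. [folklore] -/
theorem rep_smul (k : Fin N) (c : ℝ) (U : Hs W N s ι) : Hs.rep k (c • U) = c • Hs.rep k U := by
  funext x; simp [rep_apply]

/-- `evFun` is linear: subtraction. [folklore] -/
theorem evFun_sub (k : Fin N) (v : List ι) (U V : Hs W N s ι) :
    Hs.evFun k v (U - V) = Hs.evFun k v U - Hs.evFun k v V := by
  funext x; simp [evFun_apply]

end Rep

/-! ### Uniform convergence of bounded weakly convergent sequences -/

section Weak

/-- **Equi-Lipschitz families converging pointwise on a compact set converge uniformly**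
(the elementary half of Arzelà–Ascoli). [folklore] -/
theorem tendstoUniformlyOn_of_lipschitzOnWith {X Y : Type*} [PseudoMetricSpace X]
    [PseudoMetricSpace Y] {K : Set X} (hK : IsCompact K) {F : ℕ → X → Y} {f : X → Y} {L : ℝ≥0}
    (hF : ∀ n, LipschitzOnWith L (F n) K) (hf : LipschitzOnWith L f K)
    (h : ∀ x ∈ K, Tendsto (fun n => F n x) atTop (𝓝 (f x))) : TendstoUniformlyOn F f atTop K := by
  rw [Metric.tendstoUniformlyOn_iff]
  intro ε hε
  set δ : ℝ := ε / (3 * (L + 1)) with hδ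
  have hδ0 : 0 < δ := by rw [hδ]; positivity
  obtain ⟨T, hTK, hTfin, hcover⟩ := finite_cover_balls_of_compact hK hδ0
  have hT : ∀ᶠ n in atTop, ∀ t ∈ T, dist (f t) (F n t) < ε / 3 := by
    refine hTfin.eventually_all.2 fun t ht => ?_
    have := (Metric.tendsto_nhds.1 (h t (hTK ht))) (ε / 3) (by positivity)
    filter_upwards [this] with n hn
    rwa [dist_comm] at hn
  filter_upwards [hT] with n hn x hx
  obtain ⟨t, ht, hxt⟩ := mem_iUnion₂.1 (hcover hx)
  rw [mem_ball] at hxt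
  have h1 : dist (f x) (f t) ≤ L * dist x t := hf.dist_le_mul x hx t (hTK ht)
  have h2 : dist (F n t) (F n x) ≤ L * dist t x := (hF n).dist_le_mul t (hTK ht) x hx
  have h3 := hn t ht
  have hLδ : (L : ℝ) * δ ≤ ε / 3 := by
    rw [hδ]
    have hL : (0 : ℝ) ≤ L := L.2
    rw [mul_div_assoc']
    rw [div_le_div_iff₀ (by positivity) (by positivity)]
    nlinarith
  calc dist (f x) (F n x) ≤ dist (f x) (f t) + dist (f t) (F n t) + dist (F n t) (F n x) :=
        dist_triangle4 _ _ _ _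
    _ < L * δ + ε / 3 + L * δ := by
        have : dist t x < δ := by rwa [dist_comm]
        have hL : (0 : ℝ) ≤ L := L.2
        nlinarith [h1, h2, h3, mul_le_mul_of_nonneg_left hxt.le hL,
          mul_le_mul_of_nonneg_left this.le hL]
    _ ≤ ε / 3 + ε / 3 + ε / 3 := by linarith
    _ = ε := by ring

variable [CompleteSpace W] [FiniteDimensional ℝ W]

omit [CompleteSpace W] in
/-- A continuous linear map on a Hilbert space into a finite-dimensional space is sequentially
weak-to-norm continuous. [folklore] -/
theorem tendsto_clm_of_weak {H : Type*} [NormedAddCommGroup H] [InnerProductSpace ℝ H]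
    [CompleteSpace H] (T : H →L[ℝ] W) {U : ℕ → H} {U' : H}
    (hw : ∀ h : H, Tendsto (fun n => ⟪h, U n⟫) atTop (𝓝 ⟪h, U'⟫)) :
    Tendsto (fun n => T (U n)) atTop (𝓝 (T U')) := by
  -- test against the vectors of an orthonormal basis of `W`
  have hcoord : ∀ w : W, Tendsto (fun n => ⟪w, T (U n)⟫) atTop (𝓝 ⟪w, T U'⟫) := by
    intro w
    set ℓ : H →L[ℝ] ℝ := (innerSL ℝ w).comp T with hℓ
    have hh : ∀ z : H, ⟪(InnerProductSpace.toDual ℝ H).symm ℓ, z⟫ = ⟪w, T z⟫ := fun z => by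
      rw [InnerProductSpace.toDual_symm_apply]; rfl
    have := hw ((InnerProductSpace.toDual ℝ H).symm ℓ)
    simp only [hh] at this
    exact this
  -- finite-dimensional target: coordinatewise convergence suffices
  set b := stdOrthonormalBasis ℝ W with hb
  have hrepr : ∀ y : W, y = ∑ i, ⟪b i, y⟫ • b i := fun y => (b.sum_repr' y).symm
  rw [hrepr (T U')]
  have : (fun n => T (U n)) = fun n => ∑ i, ⟪b i, T (U n)⟫ • b i := funext fun n => hrepr _
  rw [this]
  exact tendsto_finsetSum _ fun i _ => (hcoord (b i)).smul_const _

/-- **Bounded weakly convergent sequences in `𝐇_s` converge uniformly on balls together with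
their derivatives of order `m`, `m + 1 + dim ≤ s`** — the substitute for Rellich's lemma used to
verify the weak sequential continuity hypothesis of Kato–Lai's Theorem A for the Galerkin
operator. [cite: KatoLai1984, §3 Thm. A (p. 18)] -/
theorem tendstoUniformlyOn_ev_of_weak {m : ℕ} (hms : m + 1 + Fintype.card ι ≤ s)
    {U : ℕ → Hs W N s ι} {U' : Hs W N s ι}
    (hw : ∀ h : Hs W N s ι, Tendsto (fun n => ⟪h, U n⟫) atTop (𝓝 ⟪h, U'⟫))
    {B : ℝ} (hB : ∀ n, ‖U n‖ ≤ B) (k : Fin N) {v : List ι} (hv : v.length ≤ m) (R : ℝ) (hR : 0 < R) :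
    TendstoUniformlyOn (fun n => Hs.evFun k v (U n)) (Hs.evFun k v U') atTop
      (closedBall (0 : EuclideanSpace ℝ ι) R) := by
  obtain ⟨C, hC0, hC⟩ := exists_norm_ev_sub_ev_le (W := W) (N := N) hms hR
  have hB0 : 0 ≤ B := (norm_nonneg _).trans (hB 0)
  -- a common Lipschitz constant for the sequence and the limit
  have hU' : ‖U'‖ ≤ B := by
    -- weak limits do not increase the norm: `‖U'‖² = lim ⟪U', U n⟫ ≤ B ‖U'‖`
    have h1 := hw U'
    have h2 : ∀ n, ⟪U', U n⟫ ≤ ‖U'‖ * B := fun n =>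
      (real_inner_le_norm _ _).trans (mul_le_mul_of_nonneg_left (hB n) (norm_nonneg _))
    have h3 : ⟪U', U'⟫ ≤ ‖U'‖ * B := le_of_tendsto' h1 h2
    rw [real_inner_self_eq_norm_sq] at h3
    by_cases h0 : ‖U'‖ = 0
    · rw [h0]; exact hB0
    · have hpos : 0 < ‖U'‖ := lt_of_le_of_ne (norm_nonneg _) (Ne.symm h0)
      nlinarith
  set L : ℝ≥0 := ⟨C * B, mul_nonneg hC0 hB0⟩ with hL
  have hLip : ∀ V : Hs W N s ι, ‖V‖ ≤ B →
      LipschitzOnWith L (Hs.evFun k v V) (closedBall (0 : EuclideanSpace ℝ ι) R) := by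
    intro V hV
    refine LipschitzOnWith.of_dist_le_mul fun x hx x' hx' => ?_
    rw [dist_eq_norm, dist_eq_norm, evFun_apply, evFun_apply]
    calc ‖Hs.ev k v x V - Hs.ev k v x' V‖ ≤ C * ‖V‖ * ‖x - x'‖ := hC k v hv x hx x' hx' V
      _ ≤ C * B * ‖x - x'‖ := by gcongr
      _ = (L : ℝ) * ‖x - x'‖ := by rw [hL]; rfl
  refine tendstoUniformlyOn_of_lipschitzOnWith (isCompact_closedBall _ _)
    (fun n => hLip (U n) (hB n)) (hLip U' hU') fun x _ => ?_
  exact tendsto_clm_of_weak (H := Hs W N s ι) (Hs.ev k v x) hw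

end Weak

end Literature.Analysis.PDE

end
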